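import Literature.AlgebraicGeometry.HodgeTheory.NodalPencilLocalFibre
import Literature.AlgebraicGeometry.HodgeTheory.UniversalHypersurfaceFibreCoordinates
import Literature.AlgebraicGeometry.Motives.UniversalHypersurfaceRegularLocusCoordinates
import Literature.AlgebraicGeometry.Motives.UniversalHypersurfaceRegularLocusEquation
import Literature.AlgebraicGeometry.Motives.UniversalHypersurfaceRegularLocusTopology
import Literature.AlgebraicGeometry.Motives.UniversalHypersurfaceTotalSpaceOverCoordinates
import Mathlib.Topology.Homeomorph.Lemmas
import HarnessLib

/-!
# The fibres of the universal family inside the regular locus: `Y_t(ℂ) ≃ₜ {Q ∈ 𝒴°(ℂ) | b(Q) = b(t)} ≃ₜ {[z] | F_t(z) = 0}`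

Family `hodge`, layer `Literature/AlgebraicGeometry/HodgeTheory`. Written by the prover seat `hodge-nonav-prover-Bx` (g15, cell
`hodge-nonav`) as a brick of the ODP-ISOTOPY port (memo `PROGRAMME-ODP-ISOTOPY-Bx-g13` §2; Picard–Lefschetz binder hPL₁
`picardLefschetz_oneNode` of crux K1-B, stmt-HodgeConjecture-19716): the analogue of prover-Ax's `CyclicCoverPencilFibreEmbedding` for
the universal family of smooth hypersurfaces `π : 𝒴_U → U` itself. The geometric monodromy of a pencil is constructed on the regular
locus `𝒴°(ℂ)` of the universal family over ALL forms (`Motives/UniversalHypersurfaceRegularLocus*`, where the vector fields and flows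
live), while the socket `PicardLefschetzOfPencilIsotopy.exists_isPicardLefschetzData_one_of_pencilIsotopy` wants self-maps of the
projective zero sets `Z_t = {[z] | F_t(z) = 0}` and works with the fibres `Y_t(ℂ)` of `π`; this file is the dictionary.

* `fibreToReg n d t : C(Y_t(ℂ), 𝒴°(ℂ))` — `Y_t → 𝒴_U → 𝒴°` (`totalToRegular`); `regCoeff_fibreToReg` (`b = coeffVector t`),
  `hypersurfacePoint_fibreToReg` (`[z] = fibrePoint`), `fibreToReg_injective`;
* `eq_of_hypersurfacePoint_eq_of_regCoeff_eq` — a point of `𝒴°(ℂ)` is determined by `([z], b)`;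
  `hypersurfacePoint_mem_projZeroLocus_of_regCoeff_eq` — `[z](Q) ∈ Z_t` when `b(Q) = b(t)`;
  `exists_fibreToReg_eq_of_regCoeff_eq`, `range_fibreToReg` — the image of `Y_t(ℂ)` is EXACTLY `{Q | b(Q) = b(t)}`;
  `isCompact_setOf_regCoeff_eq`;
* `exists_section_projZeroLocus` — **the continuous section `σ_t : Z_t → 𝒴°(ℂ)`** with `[z](σ_t ℓ) = ℓ`, `b(σ_t ℓ) = b(t)`, and
  `σ_t [z](Q) = Q` whenever `b(Q) = b(t)`; `exists_homeomorph_projZeroLocus_setOf_regCoeff_eq` — `Z_t ≃ₜ {Q | b(Q) = b(t)}`;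
* `setOf_regCoeff_eq_eq_pencilFibre`, `isCompact_pencilFibre_of_coeffVector_eq` — for a base point `t` with `b(t) = b₀ + c·e_{xᵢ^d}`
  that set is the member `pencilFibre n d i b₀ c` of `NodalPencilLocalFibre`, hence compact.

Everything is proved; one concrete definition (`fibreToReg`); no named facts. Honest scope: a dictionary between two models of the same
fibres; nothing here says HC or any rung is proved.

## References

* [VoisinHodgeII2003] C. Voisin, Hodge Theory and Complex Algebraic Geometry II (2003), §6.2.1 (the universal hypersurface
  `𝒴 = {(x, F) | F(x) = 0}`), §2.3.1.
* [SerreGAGA1956] J.-P. Serre, Géométrie algébrique et géométrie analytique, §2 n°5 Lemme 1 b), n°7 Prop. 6.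
-/

noncomputable section

open CategoryTheory AlgebraicGeometry MvPolynomial TopologicalSpace Set Topology
open scoped LinearAlgebra.Projectivization
open Literature.AlgebraicGeometry.Motives Literature.AlgebraicGeometry.Motives.UniversalHypersurface
open Literature.AlgebraicGeometry.HodgeTheory.UniversalHypersurface Literature.NumberTheory.Transcendental

namespace Literature.AlgebraicGeometry.HodgeTheory

namespace NodalPencil

variable (n d : ℕ)

/-! ### `Y_t(ℂ) → 𝒴°(ℂ)` -/

/-- **The fibre `Y_t(ℂ)` of the universal family read in the regular locus**: `Y_t → 𝒴_U → 𝒴°`.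
[cite: VoisinHodgeII2003, §6.2.1] -/
def fibreToReg (t : ComplexPoints (base ℂ n d)) :
    C(ComplexPoints (fiberOver (family ℂ n d) t), ComplexPoints (regularTotal ℂ n d)) :=
  ⟨fun y => AlgPoints.map (totalToRegular ℂ n d) (AlgPoints.map (fiberι (family ℂ n d) t) y),
    (AlgPoints.continuous_map _).comp (AlgPoints.continuous_map _)⟩

/-- Unfolding `fibreToReg`. [cite: VoisinHodgeII2003, §6.2.1] -/
theorem fibreToReg_apply (t : ComplexPoints (base ℂ n d)) (y : ComplexPoints (fiberOver (family ℂ n d) t)) :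
    fibreToReg n d t y = AlgPoints.map (totalToRegular ℂ n d) (AlgPoints.map (fiberι (family ℂ n d) t) y) := rfl

/-- **The coefficient vector is constant on the fibre**: `b(ι_t y) = coeffVector t`. [cite: VoisinHodgeII2003, §6.2.1] -/
theorem regCoeff_fibreToReg (t : ComplexPoints (base ℂ n d)) (y : ComplexPoints (fiberOver (family ℂ n d) t)) :
    regCoeff ℂ n d (fibreToReg n d t y) = coeffVector ℂ n d t := by
  rw [fibreToReg_apply, regCoeff_map_totalToRegular, AlgPoints.map_map_fiberι]

/-- **The homogeneous coordinates of `ι_t y` are `fibrePoint t y`.** [cite: VoisinHodgeII2003, §6.2.1] -/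
theorem hypersurfacePoint_fibreToReg (t : ComplexPoints (base ℂ n d)) (y : ComplexPoints (fiberOver (family ℂ n d) t)) :
    hypersurfacePoint (regularToProjectiveSpace ℂ n d) (fibreToReg n d t y) = fibrePoint n d t y := by
  rw [fibreToReg_apply, hypersurfacePoint_map_totalToRegular, fibrePoint_eq_hypersurfacePoint_map_fiberι]

/-- `ι_t : Y_t(ℂ) → 𝒴°(ℂ)` is injective. [cite: SerreGAGA1956, §2 n°5 Lemme 1 b)] -/
theorem fibreToReg_injective (t : ComplexPoints (base ℂ n d)) : Function.Injective (fibreToReg n d t) := by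
  intro y y' h
  apply fibrePoint_injective t
  rw [← hypersurfacePoint_fibreToReg, ← hypersurfacePoint_fibreToReg, h]

/-! ### Points of `𝒴°(ℂ)` are determined by `([z], b)` -/

/-- **A point of `𝒴°(ℂ)` is determined by its homogeneous coordinates and its coefficient vector.**
[cite: VoisinHodgeII2003, §6.2.1] [cite: SerreGAGA1956, §2 n°5 Lemme 1 b)] -/
theorem eq_of_hypersurfacePoint_eq_of_regCoeff_eq {Q Q' : ComplexPoints (regularTotal ℂ n d)}
    (h₁ : hypersurfacePoint (regularToProjectiveSpace ℂ n d) Q = hypersurfacePoint (regularToProjectiveSpace ℂ n d) Q')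
    (h₂ : regCoeff ℂ n d Q = regCoeff ℂ n d Q') : Q = Q' := by
  apply (isOpenEmbedding_map_regularToTotalSpaceOver ℂ n d (L := ℂ)).injective
  refine eq_of_hypersurfacePoint_eq_of_tCoeff_eq n d ?_ ?_
  · rw [hypersurfacePoint_map_regularToTotalSpaceOver, hypersurfacePoint_map_regularToTotalSpaceOver, h₁]
  · rw [tCoeff_map_regularToTotalSpaceOver, tCoeff_map_regularToTotalSpaceOver, h₂]

/-- **`[z](Q) ∈ Z_t` when `b(Q) = b(t)`** (a point of `𝒴°` lies on the hypersurface of its own form). [cite: VoisinHodgeII2003, §6.2.1] -/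
theorem hypersurfacePoint_mem_projZeroLocus_of_regCoeff_eq {Q : ComplexPoints (regularTotal ℂ n d)}
    {t : ComplexPoints (base ℂ n d)} (h : regCoeff ℂ n d Q = coeffVector ℂ n d t) :
    hypersurfacePoint (regularToProjectiveSpace ℂ n d) Q ∈ Projectivization.projZeroLocus {pointForm ℂ n d t} := by
  have hmem := hypersurfacePoint_mem_projZeroLocus_regForm n d Q
  rwa [regForm_eq_formOfCoeffs, h, formOfCoeffs_coeffVector] at hmem

/-- **Every point of `𝒴°(ℂ)` with `b(Q) = b(t)` comes from the fibre `Y_t(ℂ)`** (`d ≥ 1`). [cite: VoisinHodgeII2003, §6.2.1] -/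
theorem exists_fibreToReg_eq_of_regCoeff_eq (hd : 1 ≤ d) {Q : ComplexPoints (regularTotal ℂ n d)}
    {t : ComplexPoints (base ℂ n d)} (h : regCoeff ℂ n d Q = coeffVector ℂ n d t) :
    ∃ y : ComplexPoints (fiberOver (family ℂ n d) t), fibreToReg n d t y = Q := by
  have hℓ := hypersurfacePoint_mem_projZeroLocus_of_regCoeff_eq n d h
  rw [← range_fibrePoint hd t] at hℓ
  obtain ⟨y, hy⟩ := hℓ
  refine ⟨y, eq_of_hypersurfacePoint_eq_of_regCoeff_eq n d ?_ ?_⟩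
  · rw [hypersurfacePoint_fibreToReg, hy]
  · rw [regCoeff_fibreToReg, h]

/-- **The image of `Y_t(ℂ)` in `𝒴°(ℂ)` is exactly `{Q | b(Q) = b(t)}`** (`d ≥ 1`). [cite: VoisinHodgeII2003, §6.2.1] -/
theorem range_fibreToReg (hd : 1 ≤ d) (t : ComplexPoints (base ℂ n d)) :
    Set.range (fibreToReg n d t) = {Q | regCoeff ℂ n d Q = coeffVector ℂ n d t} := by
  refine Set.Subset.antisymm ?_ fun Q hQ => exists_fibreToReg_eq_of_regCoeff_eq n d hd hQ
  rintro _ ⟨y, rfl⟩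
  exact regCoeff_fibreToReg n d t y

/-- `{Q | b(Q) = b(t)}` is compact (`n, d ≥ 1`; the continuous image of the compact `Y_t(ℂ)`). [cite: SerreGAGA1956, §2 n°7 Prop. 6] -/
theorem isCompact_setOf_regCoeff_eq (hn : 1 ≤ n) (hd : 1 ≤ d) (t : ComplexPoints (base ℂ n d)) :
    IsCompact {Q : ComplexPoints (regularTotal ℂ n d) | regCoeff ℂ n d Q = coeffVector ℂ n d t} := by
  haveI := compactSpace_fibre_family hn hd t
  rw [← range_fibreToReg n d hd t]
  exact isCompact_range (fibreToReg n d t).continuous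

/-! ### The section on the zero set and the homeomorphisms -/

/-- **The continuous section `σ_t : Z_t → 𝒴°(ℂ)`** (`n, d ≥ 1`): `[z](σ_t ℓ) = ℓ`, `b(σ_t ℓ) = b(t)`, and `σ_t [z](Q) = Q` whenever
`b(Q) = b(t)`. [cite: VoisinHodgeII2003, §6.2.1] [cite: SerreGAGA1956, §2 n°5 Lemme 1 b)] -/
theorem exists_section_projZeroLocus (hd : 1 ≤ d) (t : ComplexPoints (base ℂ n d)) :
    ∃ σ : C({ℓ // ℓ ∈ Projectivization.projZeroLocus {pointForm ℂ n d t}}, ComplexPoints (regularTotal ℂ n d)),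
      (∀ ℓ, hypersurfacePoint (regularToProjectiveSpace ℂ n d) (σ ℓ) = ℓ.1) ∧
      (∀ ℓ, regCoeff ℂ n d (σ ℓ) = coeffVector ℂ n d t) ∧
      (∀ (Q : ComplexPoints (regularTotal ℂ n d)) (hQ : regCoeff ℂ n d Q = coeffVector ℂ n d t),
        σ ⟨hypersurfacePoint (regularToProjectiveSpace ℂ n d) Q, hypersurfacePoint_mem_projZeroLocus_of_regCoeff_eq n d hQ⟩ = Q) ∧
      ∀ y, σ ⟨fibrePoint n d t y, fibrePoint_mem_projZeroLocus hd t y⟩ = fibreToReg n d t y := by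
  obtain ⟨es, hes⟩ := exists_homeomorph_fibrePoint hd t
  have hes_symm : ∀ q : {ℓ // ℓ ∈ Projectivization.projZeroLocus {pointForm ℂ n d t}},
      fibrePoint n d t (es.symm q) = q.1 := fun q => by
    rw [← hes, Homeomorph.apply_symm_apply]
  refine ⟨(fibreToReg n d t).comp (es.symm : C(_, ComplexPoints (fiberOver (family ℂ n d) t))), fun ℓ => ?_, fun ℓ => ?_,
    fun Q hQ => ?_, fun y => ?_⟩
  · change hypersurfacePoint (regularToProjectiveSpace ℂ n d) (fibreToReg n d t (es.symm ℓ)) = ℓ.1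
    rw [hypersurfacePoint_fibreToReg, hes_symm]
  · exact regCoeff_fibreToReg n d t _
  · change fibreToReg n d t (es.symm _) = Q
    refine eq_of_hypersurfacePoint_eq_of_regCoeff_eq n d ?_ ?_
    · rw [hypersurfacePoint_fibreToReg, hes_symm]
    · rw [regCoeff_fibreToReg, hQ]
  · change fibreToReg n d t (es.symm _) = fibreToReg n d t y
    congr 1
    apply es.injective
    rw [Homeomorph.apply_symm_apply]
    exact Subtype.ext (hes y).symm

/-- **`Z_t ≃ₜ {Q ∈ 𝒴°(ℂ) | b(Q) = b(t)}`** by `ℓ ↦ σ_t ℓ`, with inverse `Q ↦ [z](Q)` (`n, d ≥ 1`).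
[cite: VoisinHodgeII2003, §6.2.1] [cite: SerreGAGA1956, §2 n°5 Lemme 1 b) and n°7 Prop. 6] -/
theorem exists_homeomorph_projZeroLocus_setOf_regCoeff_eq (hn : 1 ≤ n) (hd : 1 ≤ d) (t : ComplexPoints (base ℂ n d)) :
    ∃ τ : {ℓ // ℓ ∈ Projectivization.projZeroLocus {pointForm ℂ n d t}} ≃ₜ
        ↥{Q : ComplexPoints (regularTotal ℂ n d) | regCoeff ℂ n d Q = coeffVector ℂ n d t},
      (∀ ℓ, hypersurfacePoint (regularToProjectiveSpace ℂ n d) (τ ℓ).1 = ℓ.1) ∧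
      ∀ Q, (τ.symm Q).1 = hypersurfacePoint (regularToProjectiveSpace ℂ n d) Q.1 := by
  haveI : T2Space (ComplexPoints (regularTotal ℂ n d)) := t2Space_regularTotal n d
  haveI := compactSpace_fibre_family hn hd t
  obtain ⟨es, hes⟩ := exists_homeomorph_fibrePoint hd t
  -- `Y_t(ℂ) ≃ₜ {Q | b(Q) = b(t)}` by `fibreToReg`
  let f : ComplexPoints (fiberOver (family ℂ n d) t) →
      ↥{Q : ComplexPoints (regularTotal ℂ n d) | regCoeff ℂ n d Q = coeffVector ℂ n d t} :=
    fun y => ⟨fibreToReg n d t y, regCoeff_fibreToReg n d t y⟩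
  have hfc : Continuous f := (fibreToReg n d t).continuous.subtype_mk _
  have hfb : Function.Bijective f := by
    refine ⟨fun y y' h => fibreToReg_injective n d t (congrArg Subtype.val h), fun Q => ?_⟩
    obtain ⟨y, hy⟩ := exists_fibreToReg_eq_of_regCoeff_eq n d hd Q.2
    exact ⟨y, Subtype.ext hy⟩
  let fe : ComplexPoints (fiberOver (family ℂ n d) t) ≃
      ↥{Q : ComplexPoints (regularTotal ℂ n d) | regCoeff ℂ n d Q = coeffVector ℂ n d t} := Equiv.ofBijective f hfb
  let fh : ComplexPoints (fiberOver (family ℂ n d) t) ≃ₜ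
      ↥{Q : ComplexPoints (regularTotal ℂ n d) | regCoeff ℂ n d Q = coeffVector ℂ n d t} :=
    Continuous.homeoOfEquivCompactToT2 (f := fe) hfc
  refine ⟨es.symm.trans fh, fun ℓ => ?_, fun Q => ?_⟩
  · change hypersurfacePoint (regularToProjectiveSpace ℂ n d) (fibreToReg n d t (es.symm ℓ)) = ℓ.1
    rw [hypersurfacePoint_fibreToReg, ← hes, Homeomorph.apply_symm_apply]
  · change (es (fh.symm Q)).1 = _
    rw [hes, ← hypersurfacePoint_fibreToReg]
    have h : fibreToReg n d t (fh.symm Q) = Q.1 := by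
      have h1 : fh (fh.symm Q) = Q := fh.apply_symm_apply Q
      exact congrArg Subtype.val h1
    rw [h]

/-! ### The members of a monomial pencil -/

variable {n d} (i : Fin (n + 2)) (b₀ : DegIndex n d → ℂ)

/-- **For a base point `t` with `b(t) = b₀ + c·e_{xᵢ^d}` the set `{Q | b(Q) = b(t)}` is the pencil member `X_c`.**
[cite: VoisinHodgeII2003, §2.3.1 and §6.2.1] -/
theorem setOf_regCoeff_eq_eq_pencilFibre {t : ComplexPoints (base ℂ n d)} {c : ℂ}
    (ht : coeffVector ℂ n d t = b₀ + Pi.single (regPowIndex n d i) c) :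
    {Q : ComplexPoints (regularTotal ℂ n d) | regCoeff ℂ n d Q = coeffVector ℂ n d t} = pencilFibre n d i b₀ c := by
  ext Q
  rw [Set.mem_setOf_eq, mem_pencilFibre_iff_regCoeff_eq b₀ c Q, ht]

/-- **The pencil member over a base point is compact** (`n, d ≥ 1`). [cite: SerreGAGA1956, §2 n°7 Prop. 6] -/
theorem isCompact_pencilFibre_of_coeffVector_eq (hn : 1 ≤ n) (hd : 1 ≤ d) {t : ComplexPoints (base ℂ n d)} {c : ℂ}
    (ht : coeffVector ℂ n d t = b₀ + Pi.single (regPowIndex n d i) c) :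
    IsCompact (pencilFibre n d i b₀ c) := by
  rw [← setOf_regCoeff_eq_eq_pencilFibre i b₀ ht]
  exact isCompact_setOf_regCoeff_eq n d hn hd t

/-- A point of the slice with pencil coordinate `c` lies on `Z_t` when `b(t) = b₀ + c·e_{xᵢ^d}`. [cite: VoisinHodgeII2003, §2.3.1] -/
theorem hypersurfacePoint_mem_projZeroLocus_of_pencilCoord_eq {t : ComplexPoints (base ℂ n d)} {c : ℂ}
    (ht : coeffVector ℂ n d t = b₀ + Pi.single (regPowIndex n d i) c) {Q : ComplexPoints (regularTotal ℂ n d)}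
    (hQ : Q ∈ pencilSlice n d i b₀) (hc : pencilCoord n d i b₀ Q = c) :
    hypersurfacePoint (regularToProjectiveSpace ℂ n d) Q ∈ Projectivization.projZeroLocus {pointForm ℂ n d t} := by
  refine hypersurfacePoint_mem_projZeroLocus_of_regCoeff_eq n d ?_
  rw [ht, ← hc]
  exact regCoeff_eq_add_single_pencilCoord n d i b₀ hQ

/-- Conversely the coefficient vector of such a point is `b(t)`. [cite: VoisinHodgeII2003, §2.3.1] -/
theorem regCoeff_eq_coeffVector_of_pencilCoord_eq {t : ComplexPoints (base ℂ n d)} {c : ℂ}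
    (ht : coeffVector ℂ n d t = b₀ + Pi.single (regPowIndex n d i) c) {Q : ComplexPoints (regularTotal ℂ n d)}
    (hQ : Q ∈ pencilSlice n d i b₀) (hc : pencilCoord n d i b₀ Q = c) :
    regCoeff ℂ n d Q = coeffVector ℂ n d t := by
  rw [ht, ← hc]
  exact regCoeff_eq_add_single_pencilCoord n d i b₀ hQ

/-- And a point over `t` lies in the slice with pencil coordinate `c`. [cite: VoisinHodgeII2003, §2.3.1] -/
theorem mem_pencilSlice_and_pencilCoord_eq_of_regCoeff_eq {t : ComplexPoints (base ℂ n d)} {c : ℂ}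
    (ht : coeffVector ℂ n d t = b₀ + Pi.single (regPowIndex n d i) c) {Q : ComplexPoints (regularTotal ℂ n d)}
    (hQ : regCoeff ℂ n d Q = coeffVector ℂ n d t) :
    Q ∈ pencilSlice n d i b₀ ∧ pencilCoord n d i b₀ Q = c := by
  rw [ht] at hQ
  exact (mem_pencilFibre_iff_regCoeff_eq b₀ c Q).mpr hQ

end NodalPencil

end Literature.AlgebraicGeometry.HodgeTheory

end
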